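import Mathlib.Probability.Moments.Variance
import Literature.MathematicalPhysics.KineticTheory.CollisionTubePairMean
import Literature.Probability.Moments.PairSumVariance
import HarnessLib

/-!
# The collision-tube functional at rung 0, variance statics: packing, the velocity-averaged tube
# mark, and the velocity variance at fixed positions

Topic `Literature/MathematicalPhysics/KineticTheory` (kind proof; static inputs of the TUBE side of the
Enskog closure at rung 0 — the variance (hA)₀ of the crux line `even-rung-mean-variance` of
`JParityClosure.EvenStressEnskog`, stmt-AtomisticToContinuum-13079).  At truncation level `1` the
collision-tube functional is the normalised double sum of `χ(t, xᵢ) g(σ³ρ̃_r(x, xᵢ))` times the PAIR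
TUBE MARK `pairTubeMark ε κ Ξ_L i j x v = tubeMark κ Ξ_L (ε⁻¹ reprSym (xᵢ − xⱼ)) vᵢ vⱼ`
(`CollisionTubeDensityWeight`, `CollisionTubePairMean`).  For the variance bookkeeping by conditioning
on the POSITIONS one needs:

* `shellCount_le_cube` — hard-sphere packing for a general flight window: in the hard-sphere domain
  every particle has at most `(3 + 4Lκ)³` partners in the near-contact shell `ε < ‖q‖ ≤ ε(1 + 2Lκ)`
  (`card_le_of_separated`; the case `2Lκ ≤ 1` is `shellCount_le`);
* `norm_mem_of_tubeMark_evenMarkTrunc_ne_zero` — a nonzero tube mark of the truncated even mark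
  `Ξ_L` forces `1 < ‖q‖ ≤ 1 + 2Lκ`; hence the VELOCITY-AVERAGED tube mark
  `φ(d) = ∫∫ tubeMark κ Ξ_L (ε⁻¹ reprSym (−d)) v v' dγ dγ` (any probability law `γ` of one velocity)
  is measurable, bounded by `2L` and supported in the torus shell
  `D = {d | ε < ‖reprSym d‖ ≤ ε(1 + 2Lκ)}`, which is measurable, symmetric and of Haar volume
  `≤ (4π/3) (ε(1 + 2Lκ))³` inside the injectivity radius (`volume_real_torusShell_le`);
* `integral_pi_decoratedTubeSum` — integrating the velocities out of the decorated tube sum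
  `Σ_{i≠j} h(xᵢ) pairTubeMark_{ij}` under `γ^{⊗(N+1)}` gives the decorated pair sum
  `Σ_{i≠j} h(xᵢ) φ(xⱼ − xᵢ)` of `HardSphereDecoratedPairSumVariance` (`integral_pi_pair`);
* `variance_pi_decoratedTubeSum_le` — at FIXED non-overlapping positions the velocity variance of
  the decorated tube sum is `≤ 32 L² (3 + 4Lκ)⁶ (N + 1)`: replacing one velocity moves only the terms
  of the shell partners of that particle, each by `≤ 4L` (bounded differences,
  `Literature.Probability.Moments.variance_le_of_bounded_differences`, and packing).

References: C. Cercignani, R. Illner, M. Pulvirenti (1994) §2.2 [CIPDiluteGases1994]; S. Boucheron,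
O. Bousquet, G. Lugosi (2004) §2 [BoucheronBousquetLugosi2004].
-/

noncomputable section

namespace Literature.MathematicalPhysics.KineticTheory

open MeasureTheory ProbabilityTheory Set Filter Function
open scoped ENNReal InnerProductSpace BigOperators
open Literature.Analysis.FluidPDE Literature.Probability.Moments

/-! ## Packing of the near-contact shell for a general flight window -/

/-- **At most `(3 + 4Lκ)³` particles in the near-contact shell** `ε < ‖q‖ ≤ ε(1 + 2Lκ)` of a particle
of a non-overlapping configuration (`Lκ ≥ 0`): the minimal images of the shell partners have norm
`≤ ε(1 + 2Lκ)` and are pairwise `≥ ε` apart (`card_le_of_separated`). [folklore] -/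
theorem shellCount_le_cube {σ : ℝ} {N : ℕ} {L κ : ℝ} (hε : 0 < hsDiameter σ N) (hLκ : 0 ≤ L * κ)
    {ζ : Config (N + 1) (Fin 3) T3}
    (hζ : ζ ∈ hardSphereDomain (Torus.geometry (Fin 3)) (N + 1) (hsDiameter σ N)) (p : Fin (N + 1)) :
    shellCount σ N L κ ζ p ≤ (3 + 4 * L * κ) ^ 3 := by
  classical
  -- adapted from `shellCount_le` (CollisionTubePullbackPacking), shell radius `ε(1 + 2Lκ)` instead of `2ε`
  set s : Finset (Fin (N + 1)) := Finset.univ.filter fun l =>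
    hsDiameter σ N < ‖sepAt ζ p l‖ ∧ ‖sepAt ζ p l‖ ≤ hsDiameter σ N * (1 + 2 * L * κ) with hs
  have hcount : shellCount σ N L κ ζ p = (s.card : ℝ) := by
    unfold shellCount shellInd
    rw [Finset.card_eq_sum_ones, Nat.cast_sum, hs, Finset.sum_filter]
    simp only [Nat.cast_one]
  rw [hcount]
  have hR : ∀ j ∈ s, ‖sepAt ζ p j‖ ≤ hsDiameter σ N * (1 + 2 * L * κ) := fun j hj => (Finset.mem_filter.1 hj).2.2
  have hsep : ∀ j ∈ s, ∀ j' ∈ s, j ≠ j' → hsDiameter σ N ≤ ‖sepAt ζ p j - sepAt ζ p j'‖ := by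
    intro j _ j' _ hne
    have hproj : Literature.Analysis.FunctionSpaces.Torus.proj (sepAt ζ p j - sepAt ζ p j') = (ζ j').1 - (ζ j).1 := by
      unfold sepAt
      rw [Torus.geometry_sepVec, Torus.geometry_sepVec, sub_eq_add_neg,
        Literature.Analysis.FunctionSpaces.Torus.proj_add, Literature.Analysis.FunctionSpaces.Torus.proj_neg,
        Torus.proj_reprSym, Torus.proj_reprSym]
      abel
    have hmin := Torus.norm_reprSym_proj_le (sepAt ζ p j - sepAt ζ p j')
    rw [hproj] at hmin
    have hcore := mem_hardSphereDomain.1 hζ j' j (Ne.symm hne)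
    rw [Torus.geometry_sepVec] at hcore
    exact hcore.trans hmin
  have hR0 : 0 ≤ hsDiameter σ N * (1 + 2 * L * κ) := mul_nonneg hε.le (by linarith)
  have h := card_le_of_separated s (fun j => sepAt ζ p j) hε hR0 hR hsep
  have h3 : 2 * (hsDiameter σ N * (1 + 2 * L * κ)) / hsDiameter σ N + 1 = 3 + 4 * L * κ := by
    field_simp; ring
  rwa [h3] at h

/-- The shell count of particle `p` of a non-overlapping position vector, read on the zipped
configuration (any velocities), is at most `(3 + 4Lκ)³`. [folklore] -/
theorem shellCount_zipConfig_le_cube {σ : ℝ} {N : ℕ} {L κ : ℝ} (hε : 0 < hsDiameter σ N) (hLκ : 0 ≤ L * κ)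
    {x : Fin (N + 1) → T3} (hx : x ∈ posDomain (hsDiameter σ N) (N + 1)) (v : Fin (N + 1) → V3)
    (p : Fin (N + 1)) : shellCount σ N L κ (zipConfig (x, v)) p ≤ (3 + 4 * L * κ) ^ 3 :=
  shellCount_le_cube hε hLκ ((zipConfig_mem_hardSphereDomain_iff _ x v).2 hx) p

/-! ## The support of the tube mark of the truncated even mark -/

/-- **A nonzero tube mark of `Ξ_L` forces `1 < ‖q‖ ≤ 1 + 2Lκ`** (`L, κ ≥ 0`): the strict tube lies in
the shell `1 < ‖q‖ ≤ 1 + κ‖w‖` and `Ξ_L` vanishes at relative speed `≥ 2L`. [folklore] -/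
theorem norm_mem_of_tubeMark_evenMarkTrunc_ne_zero (k l : Fin 3) {L κ : ℝ} (hL : 0 ≤ L) (hκ : 0 ≤ κ)
    {q v v' : V3} (h : tubeMark κ (evenMarkTrunc k l L) q v v' ≠ 0) : 1 < ‖q‖ ∧ ‖q‖ ≤ 1 + 2 * L * κ := by
  obtain ⟨h1, h2⟩ := mem_shell_of_tubeMark_ne_zero h
  have hmem : q ∈ strictTube κ (v - v') := by
    by_contra hn; exact h (by rw [tubeMark, if_neg hn])
  have hΞ : evenMarkTrunc k l L (impactNormal (v - v') q, v, v') ≠ 0 := fun hz =>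
    h (by rw [tubeMark, if_pos hmem, hz])
  have hspeed : ‖v' - v‖ < 2 * L := by
    by_contra hn; exact hΞ (evenMarkTrunc_eq_zero_of_two_mul_le' k l hL (not_lt.1 hn))
  rw [norm_sub_rev] at hspeed
  refine ⟨h1, h2.trans ?_⟩
  nlinarith [mul_le_mul_of_nonneg_left hspeed.le hκ]

/-! ## The torus shell -/

/-- The minimal image has an even norm: `‖reprSym (−d)‖ = ‖reprSym d‖`. [folklore] -/
theorem norm_reprSym_neg (d : T3) : ‖Torus.reprSym (-d)‖ = ‖Torus.reprSym d‖ := by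
  have h := Torus.euclidDist_comm (0 : T3) d
  simp only [Torus.euclidDist_eq, zero_sub, sub_zero] at h
  exact h

/-- The torus shell `{ε < ‖reprSym d‖ ≤ R}` is measurable. [folklore] -/
theorem measurableSet_torusShell (ε R : ℝ) :
    MeasurableSet {d : T3 | ε < ‖Torus.reprSym d‖ ∧ ‖Torus.reprSym d‖ ≤ R} :=
  (measurableSet_lt measurable_const Torus.measurable_reprSym.norm).inter
    (measurableSet_le Torus.measurable_reprSym.norm measurable_const)

/-- The torus shell is symmetric under `d ↦ −d`. [folklore] -/
theorem mem_torusShell_iff_neg_mem (ε R : ℝ) (d : T3) :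
    d ∈ {d : T3 | ε < ‖Torus.reprSym d‖ ∧ ‖Torus.reprSym d‖ ≤ R} ↔
      -d ∈ {d : T3 | ε < ‖Torus.reprSym d‖ ∧ ‖Torus.reprSym d‖ ≤ R} := by
  simp only [mem_setOf_eq, norm_reprSym_neg]

/-- **Haar volume of the torus shell**: `vol{ε < ‖reprSym d‖ ≤ R} ≤ (4π/3) R³` for `0 ≤ R < 1/2`
(it lies in the minimal-image ball of radius `R`, whose Haar volume is the Lebesgue volume of the
Euclidean ball, `Torus.volume_euclidDist_le`). [folklore] -/
theorem volume_real_torusShell_le (ε : ℝ) {R : ℝ} (hR0 : 0 ≤ R) (hR : R < 1 / 2) :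
    (volume {d : T3 | ε < ‖Torus.reprSym d‖ ∧ ‖Torus.reprSym d‖ ≤ R}).toReal ≤ 4 / 3 * Real.pi * R ^ 3 := by
  have hsub : {d : T3 | ε < ‖Torus.reprSym d‖ ∧ ‖Torus.reprSym d‖ ≤ R} ⊆ {d : T3 | Torus.euclidDist d 0 ≤ R} :=
    fun d hd => by simp only [mem_setOf_eq, Torus.euclidDist_eq, sub_zero]; exact hd.2
  have hvol : volume {d : T3 | Torus.euclidDist d 0 ≤ R} = ENNReal.ofReal (4 / 3 * Real.pi * R ^ 3) := by
    rw [Torus.volume_euclidDist_le hR, EuclideanSpace.volume_closedBall_fin_three, ← ENNReal.ofReal_pow hR0,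
      ← ENNReal.ofReal_mul (by positivity)]
    congr 1; ring
  calc (volume {d : T3 | ε < ‖Torus.reprSym d‖ ∧ ‖Torus.reprSym d‖ ≤ R}).toReal
      ≤ (volume {d : T3 | Torus.euclidDist d 0 ≤ R}).toReal :=
        ENNReal.toReal_mono (by rw [hvol]; exact ENNReal.ofReal_ne_top) (measure_mono hsub)
    _ = 4 / 3 * Real.pi * R ^ 3 := by rw [hvol, ENNReal.toReal_ofReal (by positivity)]

/-! ## The velocity-averaged tube mark -/

/-- **The velocity-averaged tube mark is measurable** in the relative position (Fubini measurability of
the jointly measurable `(d, v, v') ↦ tubeMark κ Ξ (ε⁻¹ reprSym (−d)) v v'`). [folklore] -/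
theorem measurable_velAvg_tubeMark (ε κ : ℝ) {Ξ : V3 × V3 × V3 → ℝ} (hΞ : Measurable Ξ) (γ : Measure V3)
    [SFinite γ] :
    Measurable fun d : T3 => ∫ p, tubeMark κ Ξ (ε⁻¹ • Torus.reprSym (-d)) p.1 p.2 ∂(γ.prod γ) := by
  have hq0 : Measurable fun d : T3 => Torus.reprSym (-d) := Torus.measurable_reprSym.comp measurable_neg
  have hq : Measurable fun d : T3 => ε⁻¹ • Torus.reprSym (-d) := hq0.const_smul ε⁻¹
  have h3 : Measurable fun z : T3 × (V3 × V3) => (ε⁻¹ • Torus.reprSym (-z.1), z.2.1, z.2.2) :=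
    (hq.comp measurable_fst).prodMk (measurable_snd.fst.prodMk measurable_snd.snd)
  -- (elaborated without expected type: unifying against the target would unfold `reprSym`)
  have hF := (measurable_tubeMark κ hΞ).comp h3
  have hS := (hF.stronglyMeasurable.integral_prod_right' (ν := γ.prod γ)).measurable
  exact hS

/-- **The velocity-averaged tube mark of `Ξ_L` is bounded by `2L`** (probability law `γ`). [folklore] -/
theorem abs_velAvg_tubeMark_le (k l : Fin 3) {L : ℝ} (hL : 0 ≤ L) (ε κ : ℝ) (γ : Measure V3)
    [IsProbabilityMeasure γ] (d : T3) :
    |∫ p, tubeMark κ (evenMarkTrunc k l L) (ε⁻¹ • Torus.reprSym (-d)) p.1 p.2 ∂(γ.prod γ)| ≤ 2 * L := by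
  have h := norm_integral_le_of_norm_le_const (μ := γ.prod γ)
    (f := fun p : V3 × V3 => tubeMark κ (evenMarkTrunc k l L) (ε⁻¹ • Torus.reprSym (-d)) p.1 p.2) (C := 2 * L)
    (ae_of_all _ fun p => by rw [Real.norm_eq_abs]; exact abs_tubeMark_le (abs_evenMarkTrunc_le k l hL) _ _ _)
  rwa [probReal_univ, mul_one, Real.norm_eq_abs] at h

/-- **The velocity-averaged tube mark of `Ξ_L` is supported in the torus shell**
`{ε < ‖reprSym d‖ ≤ ε(1 + 2Lκ)}` (`ε > 0`, `L, κ ≥ 0`; off the shell the integrand vanishes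
identically, `norm_mem_of_tubeMark_evenMarkTrunc_ne_zero`). [folklore] -/
theorem mem_torusShell_of_velAvg_ne_zero (k l : Fin 3) {L κ ε : ℝ} (hL : 0 ≤ L) (hκ : 0 ≤ κ) (hε : 0 < ε)
    (γ : Measure V3) (d : T3)
    (h : ∫ p, tubeMark κ (evenMarkTrunc k l L) (ε⁻¹ • Torus.reprSym (-d)) p.1 p.2 ∂(γ.prod γ) ≠ 0) :
    d ∈ {d : T3 | ε < ‖Torus.reprSym d‖ ∧ ‖Torus.reprSym d‖ ≤ ε * (1 + 2 * L * κ)} := by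
  by_contra hd
  apply h
  refine integral_eq_zero_of_ae (ae_of_all _ fun p => ?_)
  by_contra hne
  obtain ⟨h1, h2⟩ := norm_mem_of_tubeMark_evenMarkTrunc_ne_zero k l hL hκ hne
  rw [norm_smul, Real.norm_eq_abs, abs_of_pos (inv_pos.2 hε), norm_reprSym_neg] at h1 h2
  exact hd ⟨by rwa [lt_inv_mul_iff₀ hε, mul_one] at h1, by rwa [inv_mul_le_iff₀ hε] at h2⟩

/-! ## Integrating the velocities out of the decorated tube sum -/

/-- The tube mark is jointly measurable in the two velocities at a fixed relative position. [folklore] -/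
theorem measurable_tubeMark_vel₂ (κ : ℝ) {Ξ : V3 × V3 × V3 → ℝ} (hΞ : Measurable Ξ) (q : V3) :
    Measurable fun p : V3 × V3 => tubeMark κ Ξ q p.1 p.2 := by
  have h0 : Measurable fun p : V3 × V3 => (q, p) := measurable_const.prodMk measurable_id
  -- (elaborated without expected type: unifying `g ∘ ?f` against the target would unfold `tubeMark`)
  have h := (measurable_tubeMark κ hΞ).comp h0
  exact h

/-- The velocity average of one pair tube mark (`i ≠ j`, probability law `γ`): it is the
velocity-averaged tube mark at `d = xⱼ − xᵢ` (`integral_pi_pair`). [folklore] -/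
theorem integral_pi_pairTubeMark {n : ℕ} (ε κ : ℝ) {Ξ : V3 × V3 × V3 → ℝ} (hΞ : Measurable Ξ)
    (γ : Measure V3) [IsProbabilityMeasure γ] {i j : Fin n} (hij : i ≠ j) (x : Fin n → T3) :
    ∫ v, pairTubeMark ε κ Ξ i j x v ∂Measure.pi (fun _ : Fin n => γ) =
      ∫ p, tubeMark κ Ξ (ε⁻¹ • Torus.reprSym (-(x j - x i))) p.1 p.2 ∂(γ.prod γ) := by
  rw [neg_sub]
  exact integral_pi_pair γ hij (f := fun p : V3 × V3 => tubeMark κ Ξ (ε⁻¹ • Torus.reprSym (x i - x j)) p.1 p.2)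
    (measurable_tubeMark_vel₂ κ hΞ _).aestronglyMeasurable

/-- One decorated tube term is measurable in the velocities at fixed positions. [folklore] -/
theorem measurable_decoratedTubeTerm {n : ℕ} (ε κ : ℝ) {Ξ : V3 × V3 × V3 → ℝ} (hΞ : Measurable Ξ)
    (h : T3 → ℝ) (x : Fin n → T3) (i j : Fin n) :
    Measurable fun v : Fin n → V3 => if i ≠ j then h (x i) * pairTubeMark ε κ Ξ i j x v else 0 := by
  by_cases hij : i ≠ j
  · simp only [if_pos hij]
    have h0 : Measurable fun v : Fin n → V3 => (x, v) := measurable_const.prodMk measurable_id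
    have hm := (measurable_pairTubeMark ε κ hΞ i j).comp h0
    exact hm.const_mul _
  · simp only [if_neg hij]; exact measurable_const

/-- **Integrating the velocities out of the decorated tube sum** (probability law `γ`, bounded mark):
`∫ Σ_{i≠j} h(xᵢ) pairTubeMark_{ij}(x, v) dγ^{⊗} = Σ_{i≠j} h(xᵢ) φ(xⱼ − xᵢ)` with `φ` the velocity-averaged
tube mark. [folklore] -/
theorem integral_pi_decoratedTubeSum {n : ℕ} (ε κ : ℝ) {Ξ : V3 × V3 × V3 → ℝ} (hΞ : Measurable Ξ)
    {C : ℝ} (hC : ∀ p, |Ξ p| ≤ C) (h : T3 → ℝ) (γ : Measure V3) [IsProbabilityMeasure γ] (x : Fin n → T3) :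
    ∫ v, (∑ i, ∑ j, if i ≠ j then h (x i) * pairTubeMark ε κ Ξ i j x v else 0) ∂Measure.pi (fun _ : Fin n => γ) =
      ∑ i, ∑ j, if i ≠ j then
        h (x i) * ∫ p, tubeMark κ Ξ (ε⁻¹ • Torus.reprSym (-(x j - x i))) p.1 p.2 ∂(γ.prod γ) else 0 := by
  have hint : ∀ i j, Integrable (fun v : Fin n → V3 => if i ≠ j then h (x i) * pairTubeMark ε κ Ξ i j x v else 0)
      (Measure.pi fun _ : Fin n => γ) := fun i j =>
    Integrable.of_bound (measurable_decoratedTubeTerm ε κ hΞ h x i j).aestronglyMeasurable (|h (x i)| * C)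
      (ae_of_all _ fun v => by
        rw [Real.norm_eq_abs]
        split_ifs
        · rw [abs_mul]; exact mul_le_mul_of_nonneg_left (abs_pairTubeMark_le ε κ hC i j x v) (abs_nonneg _)
        · rw [abs_zero]; exact mul_nonneg (abs_nonneg _) ((abs_nonneg _).trans (hC 0)))
  rw [integral_finsetSum _ fun i _ => integrable_finsetSum _ fun j _ => hint i j]
  refine Finset.sum_congr rfl fun i _ => ?_
  rw [integral_finsetSum _ fun j _ => hint i j]
  refine Finset.sum_congr rfl fun j _ => ?_
  by_cases hij : i ≠ j
  · simp only [if_pos hij]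
    rw [integral_const_mul, integral_pi_pairTubeMark ε κ hΞ γ hij x]
  · simp only [if_neg hij, integral_zero]

/-! ## The velocity variance of the decorated tube sum at fixed positions -/

/-- The shell indicator of a zipped configuration does not depend on the velocities. [folklore] -/
theorem shellInd_zipConfig_eq {σ : ℝ} {N : ℕ} (L κ : ℝ) (x : Fin (N + 1) → T3) (v w : Fin (N + 1) → V3)
    (a b : Fin (N + 1)) : shellInd σ N L κ (zipConfig (x, v)) a b = shellInd σ N L κ (zipConfig (x, w)) a b := rfl

/-- **One velocity moves the decorated tube sum by at most `8L` times its shell count.**  At fixed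
positions, replacing the velocity of particle `m` changes `Σ_{i≠j} h(xᵢ) pairTubeMark_{ij}(x, v)` only
through the terms with `i = m` or `j = m` AND `(i, j)` in the near-contact shell (a position event),
each by at most `2 · 2L` (`abs_tubeMark_le_shellInd`). [folklore] -/
theorem abs_decoratedTubeSum_sub_update_le {σ : ℝ} (hσ : 0 < σ) {N : ℕ} (k l : Fin 3) {L κ : ℝ}
    (hL : 0 ≤ L) (hκ : 0 ≤ κ) {h : T3 → ℝ} (hh1 : ∀ y, |h y| ≤ 1) (x : Fin (N + 1) → T3)
    (v : Fin (N + 1) → V3) (m : Fin (N + 1)) (y : V3) :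
    |(∑ i, ∑ j, if i ≠ j then h (x i) * pairTubeMark (hsDiameter σ N) κ (evenMarkTrunc k l L) i j x v else 0) -
      (∑ i, ∑ j, if i ≠ j then
        h (x i) * pairTubeMark (hsDiameter σ N) κ (evenMarkTrunc k l L) i j x (update v m y) else 0)| ≤
      8 * L * shellCount σ N L κ (zipConfig (x, v)) m := by
  have hε := hsDiameter_pos hσ N
  set v' := update v m y with hv'
  set M : (Fin (N + 1) → V3) → Fin (N + 1) → Fin (N + 1) → ℝ :=
    fun w a b => pairTubeMark (hsDiameter σ N) κ (evenMarkTrunc k l L) a b x w with hM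
  set shI : Fin (N + 1) → Fin (N + 1) → ℝ := fun a b => shellInd σ N L κ (zipConfig (x, v)) a b with hshI
  have hshI0 : ∀ a b, 0 ≤ shI a b := fun a b => shellInd_nonneg L κ _ a b
  -- each pair tube mark is bounded by `2L` times the shell indicator (a function of the positions)
  have hMle : ∀ w a b, |M w a b| ≤ 2 * L * shI a b := fun w a b => by
    have h0 := abs_tubeMark_le_shellInd hε k l hL hκ (zipConfig (x, w)) a b
    rw [shellInd_zipConfig_eq L κ x w v a b] at h0
    exact h0
  -- the decorated terms and their differences
  set T : (Fin (N + 1) → V3) → Fin (N + 1) → Fin (N + 1) → ℝ :=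
    fun w a b => if a ≠ b then h (x a) * M w a b else 0 with hT
  have hTle : ∀ w a b, |T w a b| ≤ 2 * L * shI a b := fun w a b => by
    simp only [hT]
    split_ifs
    · rw [abs_mul]
      exact (mul_le_mul (hh1 _) (hMle w a b) (abs_nonneg _) zero_le_one).trans_eq (one_mul _)
    · rw [abs_zero]; exact mul_nonneg (by linarith) (hshI0 a b)
  have hdiff : ∀ a b, |T v a b - T v' a b| ≤
      4 * L * shI a b * ((if a = m then (1 : ℝ) else 0) + (if b = m then (1 : ℝ) else 0)) := by
    intro a b
    by_cases hab : a = m ∨ b = m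
    · have h1 : (1 : ℝ) ≤ (if a = m then (1 : ℝ) else 0) + (if b = m then (1 : ℝ) else 0) := by
        rcases hab with ha | hb
        · rw [if_pos ha]; split_ifs <;> norm_num
        · rw [if_pos hb]; split_ifs <;> norm_num
      have h2 : |T v a b - T v' a b| ≤ 4 * L * shI a b := by
        calc |T v a b - T v' a b| ≤ |T v a b| + |T v' a b| := abs_sub _ _
          _ ≤ 2 * L * shI a b + 2 * L * shI a b := add_le_add (hTle v a b) (hTle v' a b)
          _ = 4 * L * shI a b := by ring
      calc |T v a b - T v' a b| ≤ 4 * L * shI a b * 1 := by rw [mul_one]; exact h2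
        _ ≤ _ := mul_le_mul_of_nonneg_left h1 (mul_nonneg (by linarith) (hshI0 a b))
    · push Not at hab
      have hsame : T v a b = T v' a b := by
        simp only [hT, hM, pairTubeMark, hv', update_of_ne hab.1, update_of_ne hab.2]
      rw [hsame, sub_self, abs_zero]
      refine mul_nonneg (mul_nonneg (by linarith) (hshI0 a b)) (add_nonneg ?_ ?_) <;> split_ifs <;> norm_num
  -- summing the bounds: `Σ_a Σ_b 4L shI_{ab} (𝟙[a=m] + 𝟙[b=m]) = 8L · shellCount_m`
  have hsum : ∑ a, ∑ b, 4 * L * shI a b * ((if a = m then (1 : ℝ) else 0) + (if b = m then (1 : ℝ) else 0)) =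
      8 * L * shellCount σ N L κ (zipConfig (x, v)) m := by
    have e1 : ∀ a b : Fin (N + 1), 4 * L * shI a b * ((if a = m then (1 : ℝ) else 0) + (if b = m then (1 : ℝ) else 0)) =
        (if a = m then 4 * L * shI a b else 0) + (if b = m then 4 * L * shI a b else 0) := fun a b => by
      split_ifs <;> ring
    simp_rw [e1, Finset.sum_add_distrib]
    have e2 : ∑ a : Fin (N + 1), ∑ b : Fin (N + 1), (if a = m then 4 * L * shI a b else 0) = 4 * L * ∑ b, shI m b := by
      have : ∀ a : Fin (N + 1), ∑ b : Fin (N + 1), (if a = m then 4 * L * shI a b else 0) =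
          if a = m then 4 * L * ∑ b, shI a b else 0 := fun a => by
        split_ifs
        · rw [Finset.mul_sum]
        · simp
      simp_rw [this]
      rw [Finset.sum_ite_eq' Finset.univ m, if_pos (Finset.mem_univ _)]
    have e3 : ∑ a : Fin (N + 1), ∑ b : Fin (N + 1), (if b = m then 4 * L * shI a b else 0) = 4 * L * ∑ a, shI a m := by
      rw [Finset.mul_sum]
      refine Finset.sum_congr rfl fun a _ => ?_
      rw [Finset.sum_ite_eq' Finset.univ m, if_pos (Finset.mem_univ _)]
    have e4 : ∑ a : Fin (N + 1), shI a m = ∑ b, shI m b :=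
      Finset.sum_congr rfl fun a _ => shellInd_comm L κ _ a m
    rw [e2, e3, e4, shellCount]
    ring
  -- assemble
  have e : (∑ i, ∑ j, if i ≠ j then h (x i) * pairTubeMark (hsDiameter σ N) κ (evenMarkTrunc k l L) i j x v else 0) -
      (∑ i, ∑ j, if i ≠ j then h (x i) * pairTubeMark (hsDiameter σ N) κ (evenMarkTrunc k l L) i j x v' else 0) =
      ∑ a, ∑ b, (T v a b - T v' a b) := by
    simp only [hT, hM, Finset.sum_sub_distrib]
  rw [e, ← hsum]
  exact (Finset.abs_sum_le_sum_abs _ _).trans (Finset.sum_le_sum fun a _ =>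
    (Finset.abs_sum_le_sum_abs _ _).trans (Finset.sum_le_sum fun b _ => hdiff a b))

/-- **The velocity variance of the decorated tube sum at fixed non-overlapping positions** is at most
`32 L² (3 + 4Lκ)⁶ (N + 1)` under any product law `γ^{⊗(N+1)}` of the velocities (`γ` a probability
measure): bounded differences `c_m = 8L · shellCount_m ≤ 8L (3 + 4Lκ)³` (packing) in
`Var ≤ ½ Σ_m c_m²`. [folklore] -/
theorem variance_pi_decoratedTubeSum_le {σ : ℝ} (hσ : 0 < σ) {N : ℕ} (k l : Fin 3) {L κ : ℝ}
    (hL : 0 ≤ L) (hκ : 0 ≤ κ) {h : T3 → ℝ} (hh1 : ∀ y, |h y| ≤ 1) (γ : Measure V3) [IsProbabilityMeasure γ]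
    {x : Fin (N + 1) → T3} (hx : x ∈ posDomain (hsDiameter σ N) (N + 1)) :
    variance (fun v => ∑ i, ∑ j, if i ≠ j then
        h (x i) * pairTubeMark (hsDiameter σ N) κ (evenMarkTrunc k l L) i j x v else 0)
      (Measure.pi fun _ : Fin (N + 1) => γ) ≤ 32 * L ^ 2 * (3 + 4 * L * κ) ^ 6 * (N + 1 : ℕ) := by
  have hε := hsDiameter_pos hσ N
  have hΞm : Measurable (evenMarkTrunc k l L) := (continuous_evenMarkTrunc k l L).measurable
  set g : (Fin (N + 1) → V3) → ℝ := fun v => ∑ i, ∑ j, if i ≠ j then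
    h (x i) * pairTubeMark (hsDiameter σ N) κ (evenMarkTrunc k l L) i j x v else 0 with hg
  have hgm : Measurable g := Finset.measurable_sum _ fun i _ => Finset.measurable_sum _ fun j _ =>
    measurable_decoratedTubeTerm _ κ hΞm h x i j
  have hterm : ∀ v i j, |(if i ≠ j then h (x i) * pairTubeMark (hsDiameter σ N) κ (evenMarkTrunc k l L) i j x v else 0)|
      ≤ 2 * L := fun v i j => by
    split_ifs
    · rw [abs_mul]
      exact (mul_le_mul (hh1 _) (abs_pairTubeMark_le _ κ (abs_evenMarkTrunc_le k l hL) i j x v) (abs_nonneg _)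
        zero_le_one).trans_eq (one_mul _)
    · rw [abs_zero]; linarith
  have hgb : ∀ v, |g v| ≤ (N + 1 : ℕ) * ((N + 1 : ℕ) * (2 * L)) := fun v => by
    refine (Finset.abs_sum_le_sum_abs _ _).trans ?_
    calc ∑ i, |∑ j, (if i ≠ j then h (x i) * pairTubeMark (hsDiameter σ N) κ (evenMarkTrunc k l L) i j x v else 0)|
        ≤ ∑ _i : Fin (N + 1), ((N + 1 : ℕ) * (2 * L)) := Finset.sum_le_sum fun i _ =>
          (Finset.abs_sum_le_sum_abs _ _).trans ((Finset.sum_le_sum fun j _ => hterm v i j).trans (by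
            rw [Finset.sum_const, Finset.card_univ, Fintype.card_fin, nsmul_eq_mul]))
      _ = (N + 1 : ℕ) * ((N + 1 : ℕ) * (2 * L)) := by
          rw [Finset.sum_const, Finset.card_univ, Fintype.card_fin, nsmul_eq_mul]
  -- bounded differences with the position-dependent constants `8L · shellCount_m`
  set c : Fin (N + 1) → ℝ := fun m => 8 * L * shellCount σ N L κ (zipConfig (x, fun _ => (0 : V3))) m with hc
  have hdiff : ∀ m v y, |g v - g (update v m y)| ≤ c m := fun m v y => by
    have h0 := abs_decoratedTubeSum_sub_update_le hσ k l hL hκ hh1 x v m y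
    have hsc : shellCount σ N L κ (zipConfig (x, v)) m = shellCount σ N L κ (zipConfig (x, fun _ => (0 : V3))) m := rfl
    rw [hsc] at h0
    exact h0
  have hvar := variance_le_of_bounded_differences (fun _ : Fin (N + 1) => γ) hgm hgb hdiff
  -- packing
  have hC : ∀ m, c m ^ 2 ≤ (8 * L * (3 + 4 * L * κ) ^ 3) ^ 2 := fun m => by
    have h1 : 0 ≤ c m := mul_nonneg (by linarith) (Finset.sum_nonneg fun b _ => shellInd_nonneg L κ _ m b)
    have h2 : c m ≤ 8 * L * (3 + 4 * L * κ) ^ 3 :=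
      mul_le_mul_of_nonneg_left (shellCount_zipConfig_le_cube hε (mul_nonneg hL hκ) hx _ m) (by linarith)
    exact pow_le_pow_left₀ h1 h2 2
  calc variance g (Measure.pi fun _ : Fin (N + 1) => γ) ≤ (1 / 2 : ℝ) * ∑ m, c m ^ 2 := hvar
    _ ≤ (1 / 2 : ℝ) * ∑ _m : Fin (N + 1), (8 * L * (3 + 4 * L * κ) ^ 3) ^ 2 :=
        mul_le_mul_of_nonneg_left (Finset.sum_le_sum fun m _ => hC m) (by norm_num)
    _ = 32 * L ^ 2 * (3 + 4 * L * κ) ^ 6 * (N + 1 : ℕ) := by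
        rw [Finset.sum_const, Finset.card_univ, Fintype.card_fin, nsmul_eq_mul]; ring

end Literature.MathematicalPhysics.KineticTheory

end
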